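import Summits.BirchSwinnertonDyer.BirchSwinnertonDyer.Theorems.BiquadraticEisensteinDescentEisensteinHeartFlatCMInertBadKPrimeSqrtEndomorphismAllJ
import HarnessLib

set_option linter.dupNamespace false -- `Summit.BirchSwinnertonDyer.BirchSwinnertonDyer.Theorems.…` (summit = sub)
set_option autoImplicit false

/-!
# Crux `InertBadAtThree` (stmt-BirchSwinnertonDyer-19225), line `rubin_e1_inert_three` v7 — the geometric CM endomorphism `[√d_CM]` of
# `W(K̄′)` in Galois-action form AT EVERY ODD PRIME (the `p = 3` twin of BED's registered stub `stub_sqrtEndomorphism`)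

Lead-prover seat `bsd-line-ibd-p1` g8 (cell `pub/bsd-wall`, LINE mode on crux 19225). Route `BiquadraticEisensteinDescent`'s theorem
`…EisensteinHeartFlatCMInertBadKPrimeSqrtEndomorphismAllJ.stub_sqrtEndomorphism` (bsd-wall-cm-bed-w4 g7, p621092; all thirteen CM `j`) is
stated with `5 ≤ p`, but its proof uses `5 ≤ p` ONLY through `p ≠ 2` (`…BiquadraticPrimes.not_isSquare_of_cmInert hp2`; the engines
`sqrtEndomorphism_datum_of_engine` / `…OfJMem.sqrtEndomorphism_datum_of_j_mem hp2` / `…CMLeafTwentySeven` / `…J0J1728` / `…OrderTwelve` /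
`…Even` carry no bound on `p`). THIS FILE records the result at its natural generality `p ≠ 2` (`sqrtEndomorphism_of_ne_two`, proof VERBATIM,
thirteen-way case split on `W.j`) and the `p = 3` instance (`sqrtEndomorphism_three`) consumed by the `p = 3` ♭-heart composition of crux
`InertBadAtThree` (`…InertBadAtThreeHeartFlatOfParts`: the `[√d₀]` input of `…CMDatumAdapter.heartShape_xac_of_sqrt_endomorphism hp2`). At
`p = 3` the relevant `j` are those with `3` CM-inert: `d_K ∈ {−4, −7, −19, −43, −67, −163}` (`j = 1728, 287496, −3375, 16581375, −884736,
−884736000, −147197952000, −262537412640768000`); the `ℚ(√−3)`, `ℚ(√−2)`, `ℚ(√−11)` leaves are excluded by `CMInert W 3` inside the proof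
exactly as at `p ≥ 5` (e.g. `j = −12288000` forces `p ≠ 3`).

THEOREMS ONLY (no definition, no named fact, no instance, no `sorry`); UNCONDITIONAL. Supports, does not close, stmt-BirchSwinnertonDyer-19225.
BSD is not proved by any of this.

References: [SilvermanAdvancedTopics1994] II §2 Prop. II.2.3.1, Thm. II.2.2(b), App. A §3; [SilvermanAEC2009] III.4.8, Cor. III.6.3, X.5.
-/

noncomputable section

open scoped Classical NumberField

open WeierstrassCurve NumberField IsDedekindDomain Field
  Literature.NumberTheory.EllipticCurves Literature.NumberTheory.EllipticCurves.Rank1Residual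
  Summit.BirchSwinnertonDyer.BirchSwinnertonDyer.Theorems.BiquadraticEisensteinDescentEisensteinHeartFlatCMInertBadKPrimeBiquadraticPrimes
  Summit.BirchSwinnertonDyer.BirchSwinnertonDyer.Theorems.BiquadraticEisensteinDescentEisensteinHeartFlatCMInertBadKPrimeCMDatumAdapter
  Summit.BirchSwinnertonDyer.BirchSwinnertonDyer.Theorems.BiquadraticEisensteinDescentEisensteinHeartFlatCMInertBadKPrimeSqrtEndomorphismOfJMem
  Summit.BirchSwinnertonDyer.BirchSwinnertonDyer.Theorems.BiquadraticEisensteinDescentEisensteinHeartFlatCMInertBadKPrimeCMLeafTwentySeven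
  Summit.BirchSwinnertonDyer.BirchSwinnertonDyer.Theorems.BiquadraticEisensteinDescentEisensteinHeartFlatCMInertBadKPrimeSqrtEndomorphismJ0J1728
  Summit.BirchSwinnertonDyer.BirchSwinnertonDyer.Theorems.BiquadraticEisensteinDescentEisensteinHeartFlatCMInertBadKPrimeSqrtEndomorphismOrderTwelve
  Summit.BirchSwinnertonDyer.BirchSwinnertonDyer.Theorems.BiquadraticEisensteinDescentEisensteinHeartFlatCMInertBadKPrimeSqrtEndomorphismEven
  Summit.BirchSwinnertonDyer.BirchSwinnertonDyer.Theorems.BiquadraticEisensteinDescentEisensteinHeartFlatCMInertBadKPrimeSqrtEndomorphismAllJ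

namespace Summit.BirchSwinnertonDyer.BirchSwinnertonDyer.Theorems.InertBadSignedBranchesInertBadAtThreeHeartSqrtEndomorphism

/-- **The `[√d_CM]` datum at every odd prime** — `…SqrtEndomorphismAllJ.stub_sqrtEndomorphism` (p621092) with `5 ≤ p` weakened to `p ≠ 2`,
proof VERBATIM. For `W/ℚ` CM, `p` odd, CM-inert and bad, `K = K′` imaginary quadratic Heegner for `N_W`, and two distinct primes `𝔭, 𝔭′ ∋ p`
of `K′`: there are `d₀ : ℤ`, `r ∈ K̄′` with `r² = d₀`, `r ∉ K′`, `d₀` a non-square mod `p`, and an additive `ψ` on `W(K̄′)` with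
`σ ∘ ψ = ψ ∘ σ` if `σ r = r`, `σ ∘ ψ = −ψ ∘ σ` if `σ r = −r`, and `ψ ∘ ψ = d₀`. By cases on `W.j` (`j_mem_of_cmInert`); the binders `HasCM`,
`¬ Good`, Heegner are idle. [cite: SilvermanAdvancedTopics1994, II §2, Prop. II.2.3.1, Thm. II.2.2(b) and App. A §3] [cite: SilvermanAEC2009, Cor. III.6.3] -/
theorem sqrtEndomorphism_of_ne_two :
    ∀ (W : WeierstrassCurve ℚ) [W.IsElliptic] [W.IsGloballyMinimal] (p : ℕ) [Fact p.Prime]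
      [NeZero (W.conductorNorm ℤ)] (K : Type) [Field K] [NumberField K],
      W.HasCM → p ≠ 2 → CMInert W p → ¬ Good W p →
      IsImaginaryQuadratic K → SatisfiesHeegnerHypothesis (W.conductorNorm ℤ) K →
      ∀ (𝔭 𝔭' : HeightOneSpectrum (𝓞 K)), ((p : ℕ) : 𝓞 K) ∈ 𝔭.asIdeal → ((p : ℕ) : 𝓞 K) ∈ 𝔭'.asIdeal → 𝔭' ≠ 𝔭 →
      ∃ (d₀ : ℤ) (r : AlgebraicClosure K) (ψ : (W.baseChange K).geomPoints →+ (W.baseChange K).geomPoints),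
        r * r = algebraMap K (AlgebraicClosure K) (d₀ : K) ∧
        r ∉ Set.range (algebraMap K (AlgebraicClosure K)) ∧
        (∀ y : ZMod p, y * y ≠ PadicInt.toZMod ((d₀ : ℤ) : ℤ_[p])) ∧
        (∀ σ : absoluteGaloisGroup K, σ • r = r → ∀ P : (W.baseChange K).geomPoints, σ • ψ P = ψ (σ • P)) ∧
        (∀ σ : absoluteGaloisGroup K, σ • r = -r → ∀ P : (W.baseChange K).geomPoints, σ • ψ P = -ψ (σ • P)) ∧
        (∀ P, ψ (ψ P) = d₀ • P) := by
  intro W _ _ p _ _ K _ _ _ hp2 hin _ hK _ 𝔭 𝔭' h𝔭 h𝔭' hne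
  have hp : p.Prime := Fact.out
  have h2K : Module.finrank ℚ K = 2 := hK.1
  haveI : (W.baseChange K).IsElliptic := inferInstanceAs (W.map (algebraMap ℚ K)).IsElliptic
  have hjK : (W.baseChange K).j = algebraMap ℚ K W.j := by simp only [baseChange, map_j]
  -- `d_K` is a non-square mod `p`
  have hdK : ¬ IsSquare ((cmFieldDiscrOfJ W.j : ℤ) : ZMod p) := not_isSquare_of_cmInert hp2 hin
  -- casts of the five `d₀` used below
  have e3 : algebraMap K (AlgebraicClosure K) (((-3 : ℤ)) : K) = -3 := by rw [Int.cast_neg, Int.cast_ofNat, map_neg, map_ofNat]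
  have e1 : algebraMap K (AlgebraicClosure K) (((-1 : ℤ)) : K) = -1 := by rw [Int.cast_neg, Int.cast_one, map_neg, map_one]
  have e2 : algebraMap K (AlgebraicClosure K) (((-2 : ℤ)) : K) = -2 := by rw [Int.cast_neg, Int.cast_ofNat, map_neg, map_ofNat]
  rcases j_mem_of_cmInert W hin with hj | hj | hj | hj | hj | hj | hj | hj | hj | hj | hj | hj | hj
  · -- j = 0, d₀ = -3
    have hd : ¬ IsSquare (((-3 : ℤ) : ℤ) : ZMod p) := by
      rw [hj] at hdK; unfold cmFieldDiscrOfJ at hdK; norm_num at hdK ⊢; exact hdK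
    exact sqrtEndomorphism_datum_of_engine W hd K h2K h𝔭 h𝔭' hne fun r hr hr0 σ₀ hσ₀ ↦
      exists_sqrt_endomorphism_of_j_eq_zero (W.baseChange K) (by rw [hjK, hj, map_zero]) r (by rw [hr, e3]) σ₀ hσ₀
  · -- j = 54000, d₀ = -3
    have hd : ¬ IsSquare (((-3 : ℤ) : ℤ) : ZMod p) := by
      rw [hj] at hdK; unfold cmFieldDiscrOfJ at hdK; norm_num at hdK ⊢; exact hdK
    exact sqrtEndomorphism_datum_of_engine W hd K h2K h𝔭 h𝔭' hne fun r hr hr0 σ₀ hσ₀ ↦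
      exists_sqrt_endomorphism_of_j_eq_54000 (W.baseChange K) (by rw [hjK, hj]; norm_num) r (by rw [hr, e3]) σ₀ hσ₀
  · -- j = -12288000, d₀ = -27 (`…CMLeafTwentySeven`)
    have hd3 : ¬ IsSquare (((-3 : ℤ) : ℤ) : ZMod p) := by
      rw [hj] at hdK; unfold cmFieldDiscrOfJ at hdK; norm_num at hdK ⊢; exact hdK
    have hp3 : p ≠ 3 := by
      rintro rfl
      exact hin.1 (by change ((3 : ℕ) : ℤ) ∣ cmFieldDiscrOfJ W.j; rw [hj]; unfold cmFieldDiscrOfJ; norm_num)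
    have hd : ¬ IsSquare (((-27 : ℤ) : ℤ) : ZMod p) := fun h ↦ hd3 ((isSquare_neg27_iff hp3).mp h)
    exact sqrtEndomorphism_datum_of_engine W hd K h2K h𝔭 h𝔭' hne fun r hr hr0 σ₀ hσ₀ ↦
      exists_sqrt27_endomorphism_of_j_eq W hj r hr hr0 σ₀ hσ₀
  · -- j = 1728, d₀ = -1
    have hd4 : ¬ IsSquare (((2 ^ 2 * -1 : ℤ) : ℤ) : ZMod p) := by
      rw [hj] at hdK; unfold cmFieldDiscrOfJ at hdK; norm_num at hdK ⊢; exact hdK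
    have hd : ¬ IsSquare (((-1 : ℤ) : ℤ) : ZMod p) := not_isSquare_of_sq_mul 2 (-1) hd4
    exact sqrtEndomorphism_datum_of_engine W hd K h2K h𝔭 h𝔭' hne fun r hr hr0 σ₀ hσ₀ ↦
      exists_sqrt_endomorphism_of_j_eq_1728 (W.baseChange K) (by rw [hjK, hj]; norm_num) r (by rw [hr, e1]) σ₀ hσ₀
  · -- j = 287496, d₀ = -4 (even degree: [2i], ψψ = -4, r' = 2i)
    have hd : ¬ IsSquare (((-4 : ℤ) : ℤ) : ZMod p) := by
      rw [hj] at hdK; unfold cmFieldDiscrOfJ at hdK; norm_num at hdK ⊢; exact hdK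
    have h2 : (2 : AlgebraicClosure K) ≠ 0 := two_ne_zero
    refine sqrtEndomorphism_datum_of_engine W hd K h2K h𝔭 h𝔭' hne fun r hr hr0 σ₀ hσ₀ ↦ ?_
    -- `i := r / 2`
    have e4 : algebraMap K (AlgebraicClosure K) (((-4 : ℤ)) : K) = -4 := by rw [Int.cast_neg, Int.cast_ofNat, map_neg, map_ofNat]
    set i : AlgebraicClosure K := r / 2 with hidef
    have hri : r = 2 * i := by rw [hidef]; field_simp
    have hi : i ^ 2 = -1 := by rw [hidef, div_pow, hr, e4]; norm_num
    have hσ2 : ∀ σ : absoluteGaloisGroup K, σ • (2 * i) = 2 * (σ • i) := fun σ ↦ by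
      rw [Field.absoluteGaloisGroup.smul_def, Field.absoluteGaloisGroup.smul_def, map_mul, map_ofNat]
    have hσ₀i : σ₀ • i = -i := by
      have h := hσ₀
      rw [hri, hσ2, ← mul_neg] at h
      exact mul_left_cancel₀ h2 h
    obtain ⟨ψ, h1, h2', h3⟩ := exists_sqrt_endomorphism_of_j_eq_287496 (W.baseChange K) (by rw [hjK, hj]; norm_num) i hi σ₀ hσ₀i
    refine ⟨ψ, fun σ hσ P ↦ h1 σ ?_ P, fun σ hσ P ↦ h2' σ ?_ P, fun P ↦ by rw [h3]⟩
    · rw [hri, hσ2] at hσ; exact mul_left_cancel₀ h2 hσ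
    · rw [hri, hσ2, ← mul_neg] at hσ; exact mul_left_cancel₀ h2 hσ
  · exact sqrtEndomorphism_datum_of_j_mem W hp2 (Or.inl hj) hin K h2K h𝔭 h𝔭' hne
  · exact sqrtEndomorphism_datum_of_j_mem W hp2 (Or.inr (Or.inl hj)) hin K h2K h𝔭 h𝔭' hne
  · -- j = 8000, d₀ = -2 (even degree: [√-2])
    have hd8 : ¬ IsSquare (((2 ^ 2 * -2 : ℤ) : ℤ) : ZMod p) := by
      rw [hj] at hdK; unfold cmFieldDiscrOfJ at hdK; norm_num at hdK ⊢; exact hdK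
    have hd : ¬ IsSquare (((-2 : ℤ) : ℤ) : ZMod p) := not_isSquare_of_sq_mul 2 (-2) hd8
    exact sqrtEndomorphism_datum_of_engine W hd K h2K h𝔭 h𝔭' hne fun r hr hr0 σ₀ hσ₀ ↦
      exists_sqrt_endomorphism_of_j_eq_8000 (W.baseChange K) (by rw [hjK, hj]; norm_num) r (by rw [hr, e2]) σ₀ hσ₀
  · exact sqrtEndomorphism_datum_of_j_mem W hp2 (Or.inr (Or.inr (Or.inl hj))) hin K h2K h𝔭 h𝔭' hne
  · exact sqrtEndomorphism_datum_of_j_mem W hp2 (Or.inr (Or.inr (Or.inr (Or.inl hj)))) hin K h2K h𝔭 h𝔭' hne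
  · exact sqrtEndomorphism_datum_of_j_mem W hp2 (Or.inr (Or.inr (Or.inr (Or.inr (Or.inl hj))))) hin K h2K h𝔭 h𝔭' hne
  · exact sqrtEndomorphism_datum_of_j_mem W hp2 (Or.inr (Or.inr (Or.inr (Or.inr (Or.inr (Or.inl hj)))))) hin K h2K h𝔭 h𝔭' hne
  · exact sqrtEndomorphism_datum_of_j_mem W hp2 (Or.inr (Or.inr (Or.inr (Or.inr (Or.inr (Or.inr hj)))))) hin K h2K h𝔭 h𝔭' hne

/-- **The `[√d_CM]` datum at `p = 3`** — the instance consumed by the `p = 3` ♭-heart composition of crux `InertBadAtThree` (line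
`rubin_e1_inert_three` v7; the `[√d₀]` input of `…CMDatumAdapter.heartShape_xac_of_sqrt_endomorphism` at `p = 3`).
[cite: SilvermanAdvancedTopics1994, II §2, Thm. II.2.2(b)] -/
theorem sqrtEndomorphism_three :
    ∀ (W : WeierstrassCurve ℚ) [W.IsElliptic] [W.IsGloballyMinimal] (p : ℕ) [Fact p.Prime]
      [NeZero (W.conductorNorm ℤ)] (K : Type) [Field K] [NumberField K],
      W.HasCM → p = 3 → CMInert W p → ¬ Good W p →
      IsImaginaryQuadratic K → SatisfiesHeegnerHypothesis (W.conductorNorm ℤ) K →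
      ∀ (𝔭 𝔭' : HeightOneSpectrum (𝓞 K)), ((p : ℕ) : 𝓞 K) ∈ 𝔭.asIdeal → ((p : ℕ) : 𝓞 K) ∈ 𝔭'.asIdeal → 𝔭' ≠ 𝔭 →
      ∃ (d₀ : ℤ) (r : AlgebraicClosure K) (ψ : (W.baseChange K).geomPoints →+ (W.baseChange K).geomPoints),
        r * r = algebraMap K (AlgebraicClosure K) (d₀ : K) ∧
        r ∉ Set.range (algebraMap K (AlgebraicClosure K)) ∧
        (∀ y : ZMod p, y * y ≠ PadicInt.toZMod ((d₀ : ℤ) : ℤ_[p])) ∧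
        (∀ σ : absoluteGaloisGroup K, σ • r = r → ∀ P : (W.baseChange K).geomPoints, σ • ψ P = ψ (σ • P)) ∧
        (∀ σ : absoluteGaloisGroup K, σ • r = -r → ∀ P : (W.baseChange K).geomPoints, σ • ψ P = -ψ (σ • P)) ∧
        (∀ P, ψ (ψ P) = d₀ • P) :=
  fun W _ _ p _ _ K _ _ hCM hp3 hin hbad hK hHN 𝔭 𝔭' h𝔭 h𝔭' hne ↦
    sqrtEndomorphism_of_ne_two W p K hCM (by omega) hin hbad hK hHN 𝔭 𝔭' h𝔭 h𝔭' hne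

end Summit.BirchSwinnertonDyer.BirchSwinnertonDyer.Theorems.InertBadSignedBranchesInertBadAtThreeHeartSqrtEndomorphism

end
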